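/-
Copyright (c) 2026 the pub-hodgecm-mathlib formalisation cell (harness21).  Prover seat hodgecm-mathlib-K2E4-p10 (g7), Track B ∕ K2-LIT, h413 = `stmt-HodgeConjecture-24833`,
line `K2_E1_TraceFormulaBeta`, 5Res ROADCARD «ENDGAME BY FAMILIES» §3′ M2 v2 (K2E1-plan (g7), (204)∕(207)∕(232)∕(234)) file D4′c (SD) part 4a: POSITIVE residue operators give GRAM
model vectors (the residue-model letter `r` of ★ `K2E1PseudoEisensteinPlancherelIsometryOperator.exists_linearIsometry_of_twoTerm_gram`) — Mathlib-only, via the C⋆-square root.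
-/
import Mathlib.Analysis.SpecialFunctions.ContinuousFunctionalCalculus.Rpow.Basic
import Mathlib.Analysis.InnerProductSpace.StarOrder
import Mathlib.Analysis.InnerProductSpace.Positive
import Mathlib.Analysis.InnerProductSpace.PiL2
import Mathlib.Analysis.CStarAlgebra.ContinuousLinearMap
import HarnessLib

/-!
# D4′c (SD) part 4a — `K2E1PositiveResidueGramModel`: a finite family of POSITIVE operators `R_c` on a Hilbert space `V` and vectors `w_{i,c} ∈ V` admit MODEL VECTORS `r_i ∈ ⊕_c V` with
# `⟪r_i, r_j⟫ = C·Σ_c ⟪w_{i,c}, R_c w_{j,c}⟫` (`r_i = (√C·R_c^{1/2} w_{i,c})_c`) — the residue part of the self-dual Plancherel isometry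

Track B ∕ K2-LIT, crux h413 = `stmt-HodgeConjecture-24833`, route of record `HCCMUnconditional`; cell `hodgecm-mathlib`, squad K2, ENGINE E1.  THEOREMS ONLY (no `def`, no `instance`,
no `notation`, no named-fact hypothesis, no `sorry`; default heartbeats); lane `--supports stmt-HodgeConjecture-24833 --as helper` (count-neutral).  Mathlib-only; no automorphic object.
THE MATHEMATICS ([MoeglinWaldspurger1995, IV.3.12 (b), V.3.2]; [ReedSimonI1980, Thm. VI.9]).  After the contour shift (★ `K2E1PseudoEisensteinContourShiftVector`) the Gram form of a self-dual
`χ`-family at a `K`-type is `⟪x_i, x_j⟫ = C·Σ_{c∈S} ⟪Ψ̂_i(−c), R_c Ψ̂_j(−c)⟫_V + (axis term)`, `R_c = Res_{z=c} M(z; χ)` the residue operators at the finitely many simple real poles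
`c ∈ (½, 1]`.  The `⊕`-isometry ★ `exists_linearIsometry_of_twoTerm_gram` needs the residue part as an honest Gram form `⟪r_i, r_j⟫_{M₁}`.  The residue operators are POSITIVE (the residue
form is `‖Res_{z=c} E(Ψ)‖²_{L²(X)}` — MW IV.3.12 (b); here a LETTER `IsPositive (R c)`), and a positive bounded operator on a Hilbert space has a positive square root `R^{1/2}`
(`R^{1/2}·R^{1/2} = R`, `(R^{1/2})† = R^{1/2}`: Mathlib's continuous functional calculus `CFC.sqrt` in the C⋆-algebra `V →L[ℂ] V`), so `⟪R^{1/2}x, R^{1/2}y⟫ = ⟪x, R y⟫` (§1) and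
`r_i := (√C·R_c^{1/2} w_{i,c})_{c} ∈ ⊕_c V` (`PiLp 2`) has `⟪r_i, r_j⟫ = C·Σ_c ⟪w_{i,c}, R_c w_{j,c}⟫` (§2).  §3 prints the `Finset ℝ` shape of ★ `pseudoEisenstein_contourShift_vector_of_letters`'
residue block (`R : ℝ → V →ₗ[ℂ] V`, continuity automatic on a finite-dimensional `V`, or supplied as `V →L[ℂ] V`).
* §1 `inner_sqrt_sqrt_eq` (`⟪R^{1/2}x, R^{1/2}y⟫ = ⟪x, Ry⟫` for positive `R`).  * §2 **`exists_gram_of_isPositive`** (Fintype index).  * §3 **`exists_gram_of_isPositive_finset`** (`∑ c ∈ S`, `R : ℝ → V →L[ℂ] V`).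
HONEST LABEL: HC_CM is proved only modulo the 7 printed citations (2 remaining named inputs: hLiu418 = `stmt-HodgeConjecture-24832`, h413 = `stmt-HodgeConjecture-24833`) until rung 0
closes; this file asserts no named fact, closes no socket; count-neutral; letter at instantiation: positivity of the residue operators.

## References
* [MoeglinWaldspurger1995] C. Mœglin, J.-L. Waldspurger, *Spectral decomposition and Eisenstein series* (1995), IV.3.12, V.3.2.
* [ReedSimonI1980] M. Reed, B. Simon, *Methods of Modern Mathematical Physics I* (1980), Thm. VI.9 (square root lemma).
-/

set_option autoImplicit false
set_option linter.dupNamespace false  -- the mandated namespace repeats the summit's segment (`HodgeConjecture.HodgeConjecture`)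

noncomputable section

open scoped InnerProductSpace ComplexConjugate BigOperators

namespace Summit.HodgeConjecture.HodgeConjecture.Cruxes.H413.K2E1PositiveResidueGramModel

variable {V : Type*} [NormedAddCommGroup V] [InnerProductSpace ℂ V] [CompleteSpace V]

/-! ## §1 The positive square root absorbs the operator into the inner product -/

/-- **`⟪R^{1/2} x, R^{1/2} y⟫ = ⟪x, R y⟫` for a POSITIVE bounded operator `R` on a Hilbert space** (`R^{1/2} := CFC.sqrt R`, self-adjoint with `R^{1/2}·R^{1/2} = R`).
[cite: ReedSimonI1980, Thm. VI.9] -/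
theorem inner_sqrt_sqrt_eq (R : V →L[ℂ] V) (hR : R.IsPositive) (x y : V) : ⟪CFC.sqrt R x, CFC.sqrt R y⟫_ℂ = ⟪x, R y⟫_ℂ := by
  have h0 : (0 : V →L[ℂ] V) ≤ R := (ContinuousLinearMap.nonneg_iff_isPositive R).2 hR
  have h1 : CFC.sqrt R * CFC.sqrt R = R := CFC.sqrt_mul_sqrt_self R h0
  have h2 : IsSelfAdjoint (CFC.sqrt R) := (CFC.sqrt_nonneg R).isSelfAdjoint
  rw [← ContinuousLinearMap.adjoint_inner_right, ← ContinuousLinearMap.star_eq_adjoint, h2.star_eq,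
    show CFC.sqrt R (CFC.sqrt R y) = (CFC.sqrt R * CFC.sqrt R) y from rfl, h1]

/-! ## §2 Gram model vectors in `⊕_c V` -/

/-- **POSITIVE RESIDUE OPERATORS GIVE GRAM MODEL VECTORS**: for positive `R_c` (`c ∈ γ` finite), vectors `w_{i,c} ∈ V` and `C ≥ 0` there are `r_i ∈ ⊕_c V` (`PiLp 2`) with
`⟪r_i, r_j⟫ = C·Σ_c ⟪w_{i,c}, R_c w_{j,c}⟫` for all `i, j` — namely `r_i = (√C • R_c^{1/2} w_{i,c})_c`.  This is the residue-model letter `r` of ★ `exists_linearIsometry_of_twoTerm_gram`.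
[cite: MoeglinWaldspurger1995, IV.3.12] [cite: ReedSimonI1980, Thm. VI.9] -/
theorem exists_gram_of_isPositive {ι γ : Type*} [Fintype γ] (R : γ → V →L[ℂ] V) (hR : ∀ c, (R c).IsPositive) (w : ι → γ → V) {C : ℝ} (hC : 0 ≤ C) :
    ∃ r : ι → PiLp 2 (fun _ : γ => V), ∀ i j, ⟪r i, r j⟫_ℂ = (C : ℂ) * ∑ c, ⟪w i c, R c (w j c)⟫_ℂ := by
  refine ⟨fun i => WithLp.toLp 2 fun c => ((Real.sqrt C : ℝ) : ℂ) • CFC.sqrt (R c) (w i c), fun i j => ?_⟩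
  rw [PiLp.inner_apply, Finset.mul_sum]
  refine Finset.sum_congr rfl fun c _ => ?_
  rw [inner_smul_left, inner_smul_right, Complex.conj_ofReal, ← mul_assoc, ← Complex.ofReal_mul, Real.mul_self_sqrt hC, inner_sqrt_sqrt_eq (R c) (hR c)]

/-! ## §3 The `Finset ℝ` print (★ `pseudoEisenstein_contourShift_vector_of_letters`' residue block) -/

/-- **THE RESIDUE BLOCK OF ★ `K2E1PseudoEisensteinContourShiftVector` AS A GRAM FORM**: for a finset `S` of (real) poles, residue operators `R : ℝ → V →L[ℂ] V` positive at every `c ∈ S`,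
vectors `w_i(c) ∈ V` (`= Ψ̂_i(−c)`) and `C ≥ 0`: `∃ r : ι → ⊕_{c∈S} V` with **`⟪r_i, r_j⟫ = C·Σ_{c∈S} ⟪w_i(c), R_c w_j(c)⟫`**. [cite: MoeglinWaldspurger1995, IV.3.12] -/
theorem exists_gram_of_isPositive_finset {ι : Type*} (S : Finset ℝ) (R : ℝ → V →L[ℂ] V) (hR : ∀ c ∈ S, (R c).IsPositive) (w : ι → ℝ → V) {C : ℝ} (hC : 0 ≤ C) :
    ∃ r : ι → PiLp 2 (fun _ : ↥S => V), ∀ i j, ⟪r i, r j⟫_ℂ = (C : ℂ) * ∑ c ∈ S, ⟪w i c, R c (w j c)⟫_ℂ := by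
  obtain ⟨r, hr⟩ := exists_gram_of_isPositive (fun c : ↥S => R c) (fun c => hR c c.2) (fun i (c : ↥S) => w i c) hC
  refine ⟨r, fun i j => ?_⟩
  rw [hr i j, ← Finset.sum_coe_sort S]

/-- The same with the residue operators given as LINEAR maps on a finite-dimensional `V` (the currency of ★ `pseudoEisenstein_contourShift_vector_of_letters`, `R : ℝ → V →ₗ[ℂ] V`;
continuity is automatic), positivity stated as `0 ≤ re ⟪v, R_c v⟫` together with symmetry `⟪x, R_c y⟫ = ⟪R_c x, y⟫`. [cite: MoeglinWaldspurger1995, IV.3.12] -/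
theorem exists_gram_of_nonneg_finset [FiniteDimensional ℂ V] {ι : Type*} (S : Finset ℝ) (R : ℝ → V →ₗ[ℂ] V)
    (hRsymm : ∀ c ∈ S, ∀ x y : V, ⟪x, R c y⟫_ℂ = ⟪R c x, y⟫_ℂ) (hRpos : ∀ c ∈ S, ∀ v : V, 0 ≤ RCLike.re ⟪v, R c v⟫_ℂ) (w : ι → ℝ → V) {C : ℝ} (hC : 0 ≤ C) :
    ∃ r : ι → PiLp 2 (fun _ : ↥S => V), ∀ i j, ⟪r i, r j⟫_ℂ = (C : ℂ) * ∑ c ∈ S, ⟪w i c, R c (w j c)⟫_ℂ := by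
  have hpos : ∀ c ∈ S, (LinearMap.toContinuousLinearMap (R c)).IsPositive := fun c hc => by
    refine ⟨fun x y => ?_, fun v => ?_⟩
    · simpa using (hRsymm c hc x y).symm
    · have h := hRpos c hc v
      rw [hRsymm c hc v v] at h
      simpa [ContinuousLinearMap.reApplyInnerSelf] using h
  obtain ⟨r, hr⟩ := exists_gram_of_isPositive_finset S (fun c => LinearMap.toContinuousLinearMap (R c)) hpos w hC
  exact ⟨r, fun i j => by simpa using hr i j⟩

end Summit.HodgeConjecture.HodgeConjecture.Cruxes.H413.K2E1PositiveResidueGramModel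

end
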